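import Mathlib
import HarnessLib
import Summits.Ventures.LatticeQCDFlow.Scoring.IMHAcceptanceRecordJump
import Summits.Ventures.LatticeQCDFlow.Scoring.ReversibleKernelTauIntFloor
import Summits.Ventures.LatticeQCDFlow.Exactness.ApproxTrivializingSampler

/-!
# The acceptance record of the exact flow-MCMC chain, VI: the jump chain is reversible and
# positive — the tilt is its equilibrium

HONEST FRAMING: exact (Metropolis-corrected) sampling algorithms for lattice gauge theory;
figures of merit are autocorrelation/cost numbers at stated couplings and volumes; no
continuum-physics claim.

Venture `LatticeQCDFlow` (cell pub-lqcd), topic `Scoring`; flow / samplers seat (GEN-41).  NEW WORK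
of the cell, not a published result; no definition is introduced; nothing is cited as a fact.
Printed counterparts NAMED ONLY: equilibrium `∝ α π` and reversibility of the jump chain (accepted
states) of a Metropolis–Hastings path (Douc–Robert, Ann. Statist. 39 (2011) Lemma 1; Rosenthal et
al., arXiv:1910.13316 Prop. 5; Vihola–Helske–Franks, arXiv:1609.02541 §6); positivity of the
independence sampler (Liu, Statist. Comput. 6 (1996)).  Built on V (`IMHAcceptanceRecordJump.lean`:
`integral_imhAccept_mul_eq` "`J g = K g − (1 − α) g`", `integral_mul_exitRun`,
`hasSum_acceptedExit_prob`), I (`integral_acceptFlag_mul`), III (`real_comp_imhRecord_prod_true`),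
row 2's layer cake (`Exactness.integral_integral_imhFlow_eq_sq`) and
`integral_kop_mul_comm_of_isReversible` (`ReversibleKernelTauIntFloor.lean`).  Notation of I–V:
model `q`, weight `w > 0`, `a(x, y) = imhAccept w x y = min(1, w y / w x)`,
`α = (imhAcceptMass q w ·).toReal`, `ā = ∫ α dπ`, `K = indepMH q w`, `A = acceptFlag`,
`Z_n = (X_n, A_n)`, `P̂ = imhRecordPath q w π` (stationary path law), `π̂ = imhRecord q w ∘ₘ π`.
The accept part `(J g)(x) = ∫ a(x, y) g(y) dq(y)` is written out, never defined; `Γ(f, g) :=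
∫ f · J g dπ` is, by V, `ā ×` the joint moment `E[f(Y) g(Y')]` of TWO CONSECUTIVE ACCEPTED STATES.
* §1 (kernel) **`integral_integral_imhAccept_mul`** (`π K = π`): `∫ J g dπ = ∫ α g dπ` — THE TILT
  `α π / ā` (law of the accepted rows, III) IS THE EQUILIBRIUM OF THE JUMP KERNEL `a(x, y) q(dy) /
  α(x)`; **`integral_mul_integral_imhAccept_comm`** (`K` `π`-reversible): `Γ(f, g) = Γ(g, f)` —
  DETAILED BALANCE of the jump chain (set form `setIntegral_setIntegral_imhAccept_comm`);
  **`integral_mul_integral_imhAccept_eq_sq`** (`π = w q`): `Γ(g, g) = ∫_{u>0} (∫ 1[u < w] g dq)² du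
  ≥ 0` (`…_nonneg`) — the jump kernel is a POSITIVE operator; **`sq_integral_acceptMass_mul_le`**:
  `(∫ α g dπ)² ≤ ā Γ(g, g)` — the lag-one autocovariance of the stationary jump chain is `≥ 0`.
* §2 (path, `π = w q`) **`hasSum_integral_acceptedPair`** (`π K = π` suffices):
  `Σ_k E_P̂[A_a f(X_a) Π_{j<k}(1 − A_{a+1+j}) A_{a+1+k} g(X_{a+1+k})] = Γ(f, g)`;
  **`hasSum_acceptedExit_prob_symm`**: the pair (accepted state at `a`, next accepted state) is
  EXCHANGEABLE; **`hasSum_nextAccepted_prob`**: `Σ_k P̂(A_a = acc, k rejections, Z_{a+1+k} ∈ S' ×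
  {acc}) = π̂(S' × {acc})` — one jump carries the law of the accepted rows to itself;
  **`sq_integral_acceptFlag_mul_le`**: `E_P̂[A_a g(X_a)]² ≤ P̂(A_a = acc) · Σ_k E_P̂[A_a g(X_a) ⋯
  A_{a+1+k} g(X_{a+1+k})]` — CONSECUTIVE ACCEPTED MEASUREMENTS OF ANY BOUNDED OBSERVABLE ARE
  NONNEGATIVELY CORRELATED (a value-free, testable structural statement, like row 8's).
* §3 `flowSampler_jump_reversible`: the instance for the exact flow sampler on `SU(n)^E` under the
  hypotheses of `Exactness.flowSampler_exact_doeblin` (uniform Lüscher defect `δ`, every volume).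
NOT CLAIMED: any number of ours; not typed: the acceptance-indexed (strong-Markov) form, higher
lags, Rao–Blackwellised multiplicity moments; no CLT, no variance ranking of jump-chain versus
full-chain averages, no cost statement, nothing deciding between samplers.
-/

noncomputable section
namespace Summit.Ventures.LatticeQCDFlow.Scoring
open MeasureTheory ProbabilityTheory Filter Finset Preorder Summit.Ventures.LatticeQCDFlow.Exactness
open scoped ENNReal Topology

variable {Ω : Type*} [MeasurableSpace Ω]

/-! ### §0 Bookkeeping -/

/-- The product of two bounded measurable observables is integrable against a finite law. -/
theorem AcceptedPair.integrable_mul (μ : Measure Ω) [IsFiniteMeasure μ] {u v : Ω → ℝ}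
    (hu : Measurable u) (hv : Measurable v) {Bu Bv : ℝ} (hBu : ∀ x, |u x| ≤ Bu)
    (hBv : ∀ x, |v x| ≤ Bv) : Integrable (fun x => u x * v x) μ :=
  integrable_of_bounded μ (hu.mul hv) (C := Bu * Bv) fun x => by
    rw [abs_mul]; exact mul_le_mul (hBu x) (hBv x) (abs_nonneg _) ((abs_nonneg _).trans (hBu x))

/-- Completing the square: `0 < ā` and `0 ≤ Q − 2 (m/ā) m + (m/ā)² ā` give `m² ≤ ā Q`. -/
theorem AcceptedPair.sq_le_mul {ā m Q : ℝ} (hā : 0 < ā)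
    (h : 0 ≤ Q - m / ā * m - m / ā * m + (m / ā) ^ 2 * ā) : m ^ 2 ≤ ā * Q := by
  have key : ā * (Q - m / ā * m - m / ā * m + (m / ā) ^ 2 * ā) = ā * Q - m ^ 2 := by
    field_simp
    ring
  exact sub_nonneg.1 (key ▸ mul_nonneg hā.le h)

variable {q : Measure Ω} [IsProbabilityMeasure q] {w : Ω → ℝ} {π : Measure Ω}

omit [IsProbabilityMeasure q] in
/-- A positive measurable weight with `w · q = π` finite is `q`-integrable. -/
theorem integrable_weight_of_withDensity_eq (hw : Measurable w) (hw0 : ∀ x, 0 < w x)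
    [IsFiniteMeasure π] (hπ : (q.withDensity fun x => ENNReal.ofReal (w x)) = π) :
    Integrable w q := by
  refine ⟨hw.aestronglyMeasurable,
    (hasFiniteIntegral_iff_ofReal (ae_of_all _ fun x => (hw0 x).le)).2 ?_⟩
  rw [← setLIntegral_univ, ← withDensity_apply _ MeasurableSet.univ, hπ]
  exact measure_lt_top π _

/-! ### §1 Kernel level: the tilt is `J`-stationary, `Γ` is symmetric and positive -/

/-- **THE TILT IS THE EQUILIBRIUM OF THE JUMP KERNEL** (`π K = π`; bounded measurable `g`):
`∫ (J g) dπ = ∫ α g dπ`, i.e. `∫ α(x) [a(x, y) q(dy) / α(x)] π(dx) = α(y) π(dy)` on observables. -/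
theorem integral_integral_imhAccept_mul (hw : Measurable w) (hw0 : ∀ x, 0 < w x)
    [IsProbabilityMeasure π] (hinv : Kernel.Invariant (indepMH q w) π) {g : Ω → ℝ}
    (hg : Measurable g) {C : ℝ} (hC : ∀ x, |g x| ≤ C) :
    ∫ x, ∫ y, imhAccept w x y * g y ∂q ∂π = ∫ x, (imhAcceptMass q w x).toReal * g x ∂π := by
  haveI : Fact (Measurable w) := ⟨hw⟩
  have hI1 : Integrable (kop (indepMH q w) g) π :=
    integrable_of_bounded π (measurable_kop _ hg) (abs_kop_le _ hC)
  have hI2 : Integrable (fun x => (1 - (imhAcceptMass q w x).toReal) * g x) π :=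
    AcceptedPair.integrable_mul π (measurable_const.sub (measurable_toReal_imhAcceptMass hw)) hg
      (fun x => by simpa using abs_pow_one_sub_toReal_imhAcceptMass_le x 1) hC
  have hI3 : Integrable g π := integrable_of_bounded π hg hC
  simp_rw [integral_imhAccept_mul_eq hw hw0 hg hC]
  rw [integral_sub hI1 hI2, integral_kop _ hinv hg hC, ← integral_sub hI3 hI2]
  exact integral_congr_ae (ae_of_all _ fun x => by ring)

/-- **DETAILED BALANCE OF THE JUMP CHAIN** (`K` `π`-reversible; bounded measurable `f, g`):
`Γ(f, g) = ∫ f · J g dπ = ∫ g · J f dπ = Γ(g, f)` — the holding terms `(1 − α) f g` of `K`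
cancel. -/
theorem integral_mul_integral_imhAccept_comm (hw : Measurable w) (hw0 : ∀ x, 0 < w x)
    [IsFiniteMeasure π] (hrev : Kernel.IsReversible (indepMH q w) π) {f g : Ω → ℝ}
    (hf : Measurable f) (hg : Measurable g) {Bf Bg : ℝ} (hBf : ∀ x, |f x| ≤ Bf)
    (hBg : ∀ x, |g x| ≤ Bg) :
    ∫ x, f x * ∫ y, imhAccept w x y * g y ∂q ∂π = ∫ x, g x * ∫ y, imhAccept w x y * f y ∂q ∂π := by
  haveI : Fact (Measurable w) := ⟨hw⟩
  have hpt : ∀ x, f x * ∫ y, imhAccept w x y * g y ∂q - g x * ∫ y, imhAccept w x y * f y ∂q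
      = f x * kop (indepMH q w) g x - kop (indepMH q w) f x * g x := fun x => by
    rw [integral_imhAccept_mul_eq hw hw0 hg hBg, integral_imhAccept_mul_eq hw hw0 hf hBf]; ring
  have hcong : ∫ x, (f x * ∫ y, imhAccept w x y * g y ∂q - g x * ∫ y, imhAccept w x y * f y ∂q) ∂π
      = ∫ x, (f x * kop (indepMH q w) g x - kop (indepMH q w) f x * g x) ∂π :=
    integral_congr_ae (ae_of_all _ hpt)
  have hIfJ := AcceptedPair.integrable_mul π hf (measurable_integral_imhAccept_mul (q := q) hw hw0
    hg hBg) hBf (abs_integral_imhAccept_mul_le hw hw0 hg hBg)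
  have hIgJ := AcceptedPair.integrable_mul π hg (measurable_integral_imhAccept_mul (q := q) hw hw0
    hf hBf) hBg (abs_integral_imhAccept_mul_le hw hw0 hf hBf)
  have hIfK := AcceptedPair.integrable_mul π hf (measurable_kop (indepMH q w) hg) hBf
    (abs_kop_le _ hBg)
  have hIKg := AcceptedPair.integrable_mul π (measurable_kop (indepMH q w) hf) hg (abs_kop_le _ hBf)
    hBg
  refine sub_eq_zero.1 ?_
  rw [← integral_sub hIfJ hIgJ, hcong, integral_sub hIfK hIKg,
    integral_kop_mul_comm_of_isReversible _ hrev hf hg hBf hBg, sub_self]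

/-- Set form: `∫_S ∫_{S'} a(x, y) q(dy) π(dx) = ∫_{S'} ∫_S a(x, y) q(dy) π(dx)` — the measure
`Γ(S, S')` of V (`hasSum_acceptedExit_prob`) is SYMMETRIC. -/
theorem setIntegral_setIntegral_imhAccept_comm (hw : Measurable w) (hw0 : ∀ x, 0 < w x)
    [IsFiniteMeasure π] (hrev : Kernel.IsReversible (indepMH q w) π) {S S' : Set Ω}
    (hS : MeasurableSet S) (hS' : MeasurableSet S') :
    ∫ x in S, ∫ y in S', imhAccept w x y ∂q ∂π = ∫ x in S', ∫ y in S, imhAccept w x y ∂q ∂π := by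
  have h1 := ExitRun.abs_indicator_one_le (Ω := Ω)
  have h2 (T T' : Set Ω) (hT : MeasurableSet T) (hT' : MeasurableSet T') :
      ∫ x in T, ∫ y in T', imhAccept w x y ∂q ∂π
        = ∫ x, T.indicator 1 x * ∫ y, imhAccept w x y * T'.indicator 1 y ∂q ∂π := by
    rw [← integral_indicator hT]
    refine integral_congr_ae (ae_of_all _ fun x => ?_)
    beta_reduce
    rw [integral_imhAccept_mul_indicator _ hT']
    by_cases hx : x ∈ T <;> simp [hx]
  rw [h2 S S' hS hS', h2 S' S hS' hS]
  exact integral_mul_integral_imhAccept_comm hw hw0 hrev (measurable_one.indicator hS)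
    (measurable_one.indicator hS') (h1 S) (h1 S')

/-- `J (g − c) = J g − c α`. -/
theorem integral_imhAccept_mul_sub_const (hw : Measurable w) (hw0 : ∀ x, 0 < w x) {g : Ω → ℝ}
    (hg : Measurable g) {C : ℝ} (hC : ∀ x, |g x| ≤ C) (c : ℝ) (x : Ω) :
    ∫ y, imhAccept w x y * (g y - c) ∂q
      = ∫ y, imhAccept w x y * g y ∂q - c * (imhAcceptMass q w x).toReal := by
  have ham := measurable_imhAccept_right hw x
  have hab : ∀ y, |imhAccept w x y| ≤ 1 := fun y => by
    rw [abs_of_nonneg (imhAccept_nonneg hw0 x y)]; exact imhAccept_le_one w x y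
  simp_rw [mul_sub]
  rw [integral_sub (AcceptedPair.integrable_mul q ham hg hab hC)
    ((integrable_of_bounded q ham hab).mul_const c), integral_mul_const,
    toReal_imhAcceptMass hw hw0, mul_comm c]

/-- **`Γ(g, g)` IS A SQUARE INTEGRAL** (`π = w q`; bounded measurable `g`): `∫ g · J g dπ =
∫∫ min(w x, w y) g(x) g(y) q(dx) q(dy) = ∫_{u>0} (∫ 1[u < w] g dq)² du` (row 2's layer cake). -/
theorem integral_mul_integral_imhAccept_eq_sq (hw : Measurable w) (hw0 : ∀ x, 0 < w x)
    [IsFiniteMeasure π] (hπ : (q.withDensity fun x => ENNReal.ofReal (w x)) = π) {g : Ω → ℝ}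
    (hg : Measurable g) {C : ℝ} (hC : ∀ x, |g x| ≤ C) :
    ∫ x, g x * ∫ y, imhAccept w x y * g y ∂q ∂π
      = ∫ u in Set.Ioi (0 : ℝ), (∫ x, (if u < w x then g x else 0) ∂q) ^ 2 := by
  have hwi := integrable_weight_of_withDensity_eq hw hw0 hπ
  subst hπ
  have key := integral_integral_imhFlow_eq_sq (μ := q) hw0 hw hwi (q := fun _ => (1 : ℝ))
    (fun _ => one_pos) measurable_const (integrable_const _) hg hC
  simp only [imhFlow, div_one, mul_one] at key
  rw [integral_withDensity_eq_integral_toReal_smul hw.ennreal_ofReal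
      (ae_of_all _ fun x => ENNReal.ofReal_lt_top), ← key]
  refine integral_congr_ae (ae_of_all _ fun x => ?_)
  show (ENNReal.ofReal (w x)).toReal • (g x * ∫ y, imhAccept w x y * g y ∂q)
    = ∫ y, min (w x) (w y) * g y * g x ∂q
  rw [ENNReal.toReal_ofReal (hw0 x).le, smul_eq_mul, ← integral_const_mul, ← integral_const_mul]
  exact integral_congr_ae (ae_of_all _ fun y => by
    beta_reduce; rw [← mul_imhAccept hw0 x y]; ring)

/-- **THE JUMP KERNEL IS A POSITIVE OPERATOR**: `0 ≤ Γ(g, g) = ∫ g · J g dπ` for every bounded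
measurable `g` (`π = w q`). -/
theorem integral_mul_integral_imhAccept_nonneg (hw : Measurable w) (hw0 : ∀ x, 0 < w x)
    [IsFiniteMeasure π] (hπ : (q.withDensity fun x => ENNReal.ofReal (w x)) = π) {g : Ω → ℝ}
    (hg : Measurable g) {C : ℝ} (hC : ∀ x, |g x| ≤ C) :
    0 ≤ ∫ x, g x * ∫ y, imhAccept w x y * g y ∂q ∂π := by
  rw [integral_mul_integral_imhAccept_eq_sq hw hw0 hπ hg hC]
  exact integral_nonneg fun u => sq_nonneg _

/-- **THE LAG-ONE AUTOCOVARIANCE OF THE JUMP CHAIN IS NONNEGATIVE** (`π = w q`; bounded measurable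
`g`): `(∫ α g dπ)² ≤ ā · ∫ g · J g dπ`, i.e. for two consecutive accepted states `Y, Y'` in
equilibrium `Cov(g(Y), g(Y')) = Γ(g, g)/ā − (∫ α g dπ / ā)² ≥ 0` (`Γ ≥ 0` at `g − ∫ α g dπ / ā`). -/
theorem sq_integral_acceptMass_mul_le (hw : Measurable w) (hw0 : ∀ x, 0 < w x)
    [IsProbabilityMeasure π] (hπ : (q.withDensity fun x => ENNReal.ofReal (w x)) = π)
    {g : Ω → ℝ} (hg : Measurable g) {C : ℝ} (hC : ∀ x, |g x| ≤ C) :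
    (∫ x, (imhAcceptMass q w x).toReal * g x ∂π) ^ 2
      ≤ (∫ x, (imhAcceptMass q w x).toReal ∂π) *
          ∫ x, g x * ∫ y, imhAccept w x y * g y ∂q ∂π := by
  haveI : Fact (Measurable w) := ⟨hw⟩
  have hinv : Kernel.Invariant (indepMH q w) π := by rw [← hπ]; exact indepMH_invariant hw hw0
  have hαm := measurable_toReal_imhAcceptMass (q := q) hw
  have hJm := measurable_integral_imhAccept_mul (q := q) hw hw0 hg hC
  have hJb := abs_integral_imhAccept_mul_le (q := q) hw hw0 hg hC
  set ā := ∫ x, (imhAcceptMass q w x).toReal ∂π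
  set m := ∫ x, (imhAcceptMass q w x).toReal * g x ∂π
  set Q := ∫ x, g x * ∫ y, imhAccept w x y * g y ∂q ∂π
  refine AcceptedPair.sq_le_mul (integral_toReal_imhAcceptMass_pos hw hw0) ?_
  set c := m / ā
  have hhb : ∀ x, |g x - c| ≤ C + |c| := fun x => (abs_sub _ _).trans (add_le_add (hC x) le_rfl)
  have hpt : ∀ x, (g x - c) * ∫ y, imhAccept w x y * (g y - c) ∂q
      = g x * (∫ y, imhAccept w x y * g y ∂q) - c * ((imhAcceptMass q w x).toReal * g x
        + (∫ y, imhAccept w x y * g y ∂q) - c * (imhAcceptMass q w x).toReal) := fun x => by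
    rw [integral_imhAccept_mul_sub_const hw hw0 hg hC c x]; ring
  have i1 : Integrable (fun x => g x * ∫ y, imhAccept w x y * g y ∂q) π :=
    AcceptedPair.integrable_mul π hg hJm hC hJb
  have i2 : Integrable (fun x => (imhAcceptMass q w x).toReal * g x) π :=
    AcceptedPair.integrable_mul π hαm hg abs_toReal_imhAcceptMass_le hC
  have i3 : Integrable (fun x => ∫ y, imhAccept w x y * g y ∂q) π := integrable_of_bounded π hJm hJb
  have i4 : Integrable (fun x => c * (imhAcceptMass q w x).toReal) π :=
    (integrable_of_bounded π hαm abs_toReal_imhAcceptMass_le).const_mul c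
  have i23 : Integrable (fun x => (imhAcceptMass q w x).toReal * g x
      + ∫ y, imhAccept w x y * g y ∂q) π := i2.add i3
  have iB : Integrable (fun x => (imhAcceptMass q w x).toReal * g x
      + (∫ y, imhAccept w x y * g y ∂q) - c * (imhAcceptMass q w x).toReal) π := i23.sub i4
  calc (0 : ℝ) ≤ ∫ x, (g x - c) * ∫ y, imhAccept w x y * (g y - c) ∂q ∂π :=
        integral_mul_integral_imhAccept_nonneg hw hw0 hπ (hg.sub measurable_const) hhb
    _ = ∫ x, (g x * (∫ y, imhAccept w x y * g y ∂q) - c * ((imhAcceptMass q w x).toReal * g x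
          + (∫ y, imhAccept w x y * g y ∂q) - c * (imhAcceptMass q w x).toReal)) ∂π :=
        integral_congr_ae (ae_of_all _ hpt)
    _ = Q - c * m - c * m + c ^ 2 * ā := by
        rw [integral_sub i1 (iB.const_mul c), integral_const_mul, integral_sub i23 i4,
          integral_add i2 i3, integral_const_mul, integral_integral_imhAccept_mul hw hw0 hinv hg hC]
        ring

/-! ### §2 Path level: two consecutive accepted states, in equilibrium -/

section Path
variable [Fact (Measurable w)] [IsProbabilityMeasure π]

/-- **THE JOINT MOMENTS OF TWO CONSECUTIVE ACCEPTED STATES** (`π K = π`; bounded measurable `f, g`;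
every time `a`): `Σ_k E_P̂[A_a f(X_a) · Π_{j<k}(1 − A_{a+1+j}) · A_{a+1+k} g(X_{a+1+k})] = Γ(f, g)
= ∫ f · J g dπ` — the observable form of V's `hasSum_acceptedExit_prob`. -/
theorem hasSum_integral_acceptedPair (hw0 : ∀ x, 0 < w x)
    (hinv : Kernel.Invariant (indepMH q w) π) {f g : Ω → ℝ} (hf : Measurable f)
    (hg : Measurable g) {Bf Bg : ℝ} (hBf : ∀ x, |f x| ≤ Bf) (hBg : ∀ x, |g x| ≤ Bg) (a : ℕ) :
    HasSum (fun k => ∫ x, acceptFlag (x a) * f (x a).1 *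
        (∏ j ∈ range k, (1 - acceptFlag (x (a + 1 + j)))) *
        (acceptFlag (x (a + 1 + k)) * g (x (a + 1 + k)).1) ∂(imhRecordPath q w π))
      (∫ x, f x * ∫ y, imhAccept w x y * g y ∂q ∂π) := by
  have hw : Measurable w := Fact.out
  have hαm := measurable_toReal_imhAcceptMass (q := q) hw
  have hJm := measurable_integral_imhAccept_mul (q := q) hw hw0 hg hBg
  have hJb := abs_integral_imhAccept_mul_le (q := q) hw hw0 hg hBg
  have hfJm : Measurable fun x => f x * ∫ y, imhAccept w x y * g y ∂q := hf.mul hJm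
  have hfJb : ∀ x, |f x * ∫ y, imhAccept w x y * g y ∂q| ≤ Bf * (2 * Bg) := fun x => by
    rw [abs_mul]; exact mul_le_mul (hBf x) (hJb x) (abs_nonneg _) ((abs_nonneg _).trans (hBf x))
  refine (hasSum_integral_acceptMass_mul_geom (q := q) hw0 π hfJm hfJb).congr_fun fun k => ?_
  rw [integral_mul_exitRun hw0 hinv (Φ := fun z => acceptFlag z * f z.1)
    (measurable_acceptFlag.mul (hf.comp measurable_fst)) (C := 1 * Bf)
    (fun z => by
      rw [abs_mul]; exact mul_le_mul (abs_acceptFlag_le z) (hBf z.1) (abs_nonneg _) zero_le_one)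
    hg hBg a k]
  simp_rw [mul_assoc]
  rw [integral_acceptFlag_mul hw hw0 hinv (H := fun x => f x *
      ((1 - (imhAcceptMass q w x).toReal) ^ k * ∫ y, imhAccept w x y * g y ∂q))
    (hf.mul (((measurable_const.sub hαm).pow_const k).mul hJm)) (C := Bf * (1 * (2 * Bg)))
    fun x => by
      rw [abs_mul, abs_mul]
      exact mul_le_mul (hBf x) (mul_le_mul (abs_pow_one_sub_toReal_imhAcceptMass_le x k) (hJb x)
        (abs_nonneg _) zero_le_one) (mul_nonneg (abs_nonneg _) (abs_nonneg _))
        ((abs_nonneg _).trans (hBf x))]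
  exact integral_congr_ae (ae_of_all _ fun x => by ring)

/-- **TWO CONSECUTIVE ACCEPTED STATES ARE EXCHANGEABLE** (`π = w q`; measurable `S, S'`; every
time `a`): `Σ_k P̂(Z_a ∈ S' × {acc}, k rejections after a, Z_{a+1+k} ∈ S × {acc}) = Γ(S, S') =
∫_S ∫_{S'} a(x, y) q(dy) π(dx)` — the same value as with `S, S'` in the forward order (V). -/
theorem hasSum_acceptedExit_prob_symm (hw0 : ∀ x, 0 < w x)
    (hπ : (q.withDensity fun x => ENNReal.ofReal (w x)) = π) {S S' : Set Ω}
    (hS : MeasurableSet S) (hS' : MeasurableSet S') (a : ℕ) :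
    HasSum (fun k => (imhRecordPath q w π).real {x | x a ∈ S' ×ˢ ({true} : Set Bool) ∧
        (x (a + 1 + k) ∈ S ×ˢ ({true} : Set Bool) ∧ ∀ j < k, (x (a + 1 + j)).2 = false)})
      (∫ x in S, ∫ y in S', imhAccept w x y ∂q ∂π) := by
  have hw : Measurable w := Fact.out
  have hrev : Kernel.IsReversible (indepMH q w) π := by rw [← hπ]; exact indepMH_isReversible hw hw0
  rw [setIntegral_setIntegral_imhAccept_comm hw hw0 hrev hS hS']
  exact hasSum_acceptedExit_prob hw0 hrev.invariant hS' hS a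

/-- **ONE JUMP CARRIES THE LAW OF THE ACCEPTED ROWS TO ITSELF** (`π K = π`; measurable `S'`; every
time `a`): `Σ_k P̂(A_a = acc, k rejections after a, Z_{a+1+k} ∈ S' × {acc}) = π̂(S' × {acc}) =
∫_{S'} α dπ` (III) — the next accepted state after an accepted row is again tilt-distributed. -/
theorem hasSum_nextAccepted_prob (hw0 : ∀ x, 0 < w x) (hinv : Kernel.Invariant (indepMH q w) π)
    {S' : Set Ω} (hS' : MeasurableSet S') (a : ℕ) :
    HasSum (fun k => (imhRecordPath q w π).real {x | (x a).2 = true ∧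
        (x (a + 1 + k) ∈ S' ×ˢ ({true} : Set Bool) ∧ ∀ j < k, (x (a + 1 + j)).2 = false)})
      ((imhRecord q w ∘ₘ π).real (S' ×ˢ ({true} : Set Bool))) := by
  have hw : Measurable w := Fact.out
  have hval : ∫ x, ∫ y in S', imhAccept w x y ∂q ∂π
      = (imhRecord q w ∘ₘ π).real (S' ×ˢ ({true} : Set Bool)) := by
    rw [real_comp_imhRecord_prod_true hw hw0 hinv hS', ← integral_indicator hS']
    simp_rw [← integral_imhAccept_mul_indicator _ hS']
    rw [integral_integral_imhAccept_mul hw hw0 hinv (measurable_one.indicator hS')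
      (ExitRun.abs_indicator_one_le S')]
    exact integral_congr_ae (ae_of_all _ fun x => by by_cases hx : x ∈ S' <;> simp [hx])
  have h := hasSum_acceptedExit_prob hw0 hinv MeasurableSet.univ hS' a
  rw [Measure.restrict_univ, hval] at h
  refine h.congr_fun fun k => ?_
  congr 1; ext x
  simp only [Set.mem_setOf_eq, Set.mem_prod, Set.mem_univ, Set.mem_singleton_iff, true_and]

/-- **CONSECUTIVE ACCEPTED MEASUREMENTS ARE NONNEGATIVELY CORRELATED** (`π = w q`; bounded
measurable `g`; every time `a`): `E_P̂[A_a g(X_a)]² ≤ P̂(A_a = acc) · Σ_k E_P̂[A_a g(X_a) Π_{j<k}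
(1 − A_{a+1+j}) A_{a+1+k} g(X_{a+1+k})]`: given that row `a` is accepted, `Cov(g(X_a), g(next
accepted state)) ≥ 0` (both are tilt-distributed; §1's `sq_integral_acceptMass_mul_le`). -/
theorem sq_integral_acceptFlag_mul_le (hw0 : ∀ x, 0 < w x)
    (hπ : (q.withDensity fun x => ENNReal.ofReal (w x)) = π) {g : Ω → ℝ} (hg : Measurable g)
    {C : ℝ} (hC : ∀ x, |g x| ≤ C) (a : ℕ) :
    (∫ x, acceptFlag (x a) * g (x a).1 ∂(imhRecordPath q w π)) ^ 2
      ≤ (∫ x, acceptFlag (x a) ∂(imhRecordPath q w π)) *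
        ∑' k, ∫ x, acceptFlag (x a) * g (x a).1 *
          (∏ j ∈ range k, (1 - acceptFlag (x (a + 1 + j)))) *
          (acceptFlag (x (a + 1 + k)) * g (x (a + 1 + k)).1) ∂(imhRecordPath q w π) := by
  have hw : Measurable w := Fact.out
  have hinv : Kernel.Invariant (indepMH q w) π := by rw [← hπ]; exact indepMH_invariant hw hw0
  have h1 : ∫ x, acceptFlag (x a) * g (x a).1 ∂(imhRecordPath q w π)
      = ∫ x, (imhAcceptMass q w x).toReal * g x ∂π :=
    (chain_marginal (imhRecord_invariant hw hinv) a (f := fun z : Ω × Bool => acceptFlag z * g z.1)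
      (measurable_acceptFlag.mul (hg.comp measurable_fst)) (C := 1 * C) fun z => by
        rw [abs_mul]
        exact mul_le_mul (abs_acceptFlag_le z) (hC z.1) (abs_nonneg _) zero_le_one).trans
      (integral_acceptFlag_mul hw hw0 hinv hg hC)
  have h2 : ∫ x, acceptFlag (x a) ∂(imhRecordPath q w π) = ∫ x, (imhAcceptMass q w x).toReal ∂π :=
    (chain_marginal (imhRecord_invariant hw hinv) a (f := acceptFlag) measurable_acceptFlag (C := 1)
      abs_acceptFlag_le).trans (integral_acceptFlag hw hw0 hinv)
  rw [(hasSum_integral_acceptedPair hw0 hinv hg hg hC hC a).tsum_eq, h1, h2]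
  exact sq_integral_acceptMass_mul_le hw hw0 hπ hg hC

end Path

/-! ### §3 The lattice instance -/

section Lattice
open Literature.MathematicalPhysics.QuantumFieldTheory
open Literature.MathematicalPhysics.QuantumFieldTheory.Luscher2010
open Summit.Ventures.LatticeQCDFlow.TrivializingMaps
open scoped Matrix Matrix.Norms.Frobenius ContDiff
variable {d L n : ℕ} [NeZero L]

/-- **THE JUMP CHAIN OF AN EXACT FLOW SAMPLER ON `SU(n)^E` IS REVERSIBLE AND POSITIVELY CORRELATED —
every volume** (hypotheses of `flowSampler_exact_doeblin`: smooth action, approximately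
trivializing flow with uniform Lüscher defect `δ`, model `q = (Φ 1)_* D[V]`, `π` = Boltzmann): a
measurable weight `w` with `w · q = π` and `π K = π` (V adds `α ≥ e^{−2δ}`) such that, in
equilibrium, for every time `a`: (i) for measurable `T, T'`, `Σ_k P̂(Z_a ∈ T' × {acc}, k
rejections, Z_{a+1+k} ∈ T × {acc}) = ∫_T ∫_{T'} a dq dπ` (= the forward value of V:
exchangeability); (ii) for bounded measurable `f`, `E_P̂[A_a f(X_a)]² ≤ P̂(A_a = acc) · Σ_k
E_P̂[A_a f(X_a) ⋯ A_{a+1+k} f(X_{a+1+k})]`. -/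
theorem flowSampler_jump_reversible (B : SuBasis n)
    {S : AmbConfig d L n → ℝ} (hS : ContDiff ℝ ∞ S) {F : ℝ → AmbConfig d L n → ℝ}
    (hF : ContDiff ℝ ∞ fun p : ℝ × AmbConfig d L n => F p.1 p.2)
    {Φ} (hΦ : IsFlowMap (fun t W => -linkGrad B (F t) W) Φ) {c : ℝ → ℝ} {δ : ℝ}
    (hδ : ∀ t ∈ Set.Icc (0 : ℝ) 1, ∀ U : GaugeConfig d L (Matrix.specialUnitaryGroup (Fin n) ℂ),
      |luscherL B S t (F t) (WilsonFlow.coeConfig U) - S (WilsonFlow.coeConfig U) - c t| ≤ δ)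
    (q : Measure (GaugeConfig d L (Matrix.specialUnitaryGroup (Fin n) ℂ))) [IsProbabilityMeasure q]
    (hq : q = Measure.map (Φ 1) (trivialMeasure (Matrix.specialUnitaryGroup (Fin n) ℂ) d L))
    {π : Measure (GaugeConfig d L (Matrix.specialUnitaryGroup (Fin n) ℂ))} [IsProbabilityMeasure π]
    (hπB : π = boltzmannMeasure fun U => S (WilsonFlow.coeConfig U)) :
    ∃ w : GaugeConfig d L (Matrix.specialUnitaryGroup (Fin n) ℂ) → ℝ, Measurable w ∧
      (q.withDensity fun U => ENNReal.ofReal (w U)) = π ∧ Kernel.Invariant (indepMH q w) π ∧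
      ∀ [Fact (Measurable w)] (a : ℕ),
        (∀ (T T' : Set (GaugeConfig d L (Matrix.specialUnitaryGroup (Fin n) ℂ))),
          MeasurableSet T → MeasurableSet T' →
          HasSum (fun k => (imhRecordPath q w π).real
              {x | x a ∈ T' ×ˢ ({true} : Set Bool) ∧ (x (a + 1 + k) ∈ T ×ˢ ({true} : Set Bool) ∧
                ∀ j < k, (x (a + 1 + j)).2 = false)})
            (∫ U in T, ∫ V in T', imhAccept w U V ∂q ∂π)) ∧
        ∀ (f : GaugeConfig d L (Matrix.specialUnitaryGroup (Fin n) ℂ) → ℝ), Measurable f →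
          ∀ {C : ℝ}, (∀ U, |f U| ≤ C) →
          (∫ x, acceptFlag (x a) * f (x a).1 ∂(imhRecordPath q w π)) ^ 2
            ≤ (∫ x, acceptFlag (x a) ∂(imhRecordPath q w π)) *
              ∑' k, ∫ x, acceptFlag (x a) * f (x a).1 *
                (∏ j ∈ range k, (1 - acceptFlag (x (a + 1 + j)))) *
                (acceptFlag (x (a + 1 + k)) * f (x (a + 1 + k)).1) ∂(imhRecordPath q w π) := by
  subst hπB
  obtain ⟨w, hw, hlo, -, hπ, hinv, -, -⟩ := flowSampler_exact_doeblin B hS hF hΦ hδ q hq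
  have hw0 : ∀ U, 0 < w U := fun U => (Real.exp_pos _).trans_le (hlo U)
  exact ⟨w, hw, hπ, hinv, fun a => ⟨fun T T' hT hT' => hasSum_acceptedExit_prob_symm hw0 hπ hT hT'
    a, fun f hf C hC => sq_integral_acceptFlag_mul_le hw0 hπ hf hC a⟩⟩

end Lattice

end Summit.Ventures.LatticeQCDFlow.Scoring
end
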